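import Summits.RiemannHypothesis.RiemannHypothesis.Theorems.GapsEvoDoorsPWPoly
import Literature.NumberTheory.LFunctions.ZetaSpacingDensityRHProofs

/-!
# GapsEvoDoors — PW-SOS witness port, part 2: bumps, autocorrelations, convolution theorem

Cell rh-gaps (D-0143/D-0145), route `GapsEvoDoors`; kernel port of engine EVO-TF-2's certified
two-square Paley–Wiener SOS witnesses of record (results/rh-gaps-eng-2/W-simple-rh-gaps-eng-2).
Generic in the data (coefficient list `p`, half-width `a`, window `K`):

* `evenExt f K` (even extension of a profile on `[0, K]`, zero outside) and its cosine transform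
  `2∫₀ᴷ f(α) cos(2πuα) dα` (`cosTransform_evenExt`);
* the polynomial bump `H = bump p a` (`H(ξ) = p(ξ²)·𝟙_{|ξ| ≤ a}`), its autocorrelation
  `H ⋆ H = auto p a` in CLOSED FORM through the toolkit's `conv` (`convolution_bump`), and
  `(H ⋆ H)^ = ĥ²` with `ĥ = cosTransform H` (Mathlib's convolution theorem; `cosTransform_auto`).

Pure real/Fourier analysis; no RH, no zeta; nothing here bears on the truth of RH.
-/

noncomputable section

open MeasureTheory Set Real Filter Topology
open scoped FourierTransform Convolution
open Literature.NumberTheory.LFunctions Literature.NumberTheory.LFunctions.BGMM2023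

set_option linter.dupNamespace false  -- the mandated namespace repeats `RiemannHypothesis`

namespace Summit.RiemannHypothesis.RiemannHypothesis.Theorems.GapsEvoDoorsPW

attribute [local fun_prop] Poly.continuous_eval

/-! ## Even extensions -/

/-- `evenExt f K α = f |α|` for `|α| ≤ K` and `0` otherwise. -/
def evenExt (f : ℝ → ℝ) (K : ℝ) (α : ℝ) : ℝ := if |α| ≤ K then f |α| else 0

/-- `evenExt f K` is even. -/
theorem evenExt_neg (f : ℝ → ℝ) (K α : ℝ) : evenExt f K (-α) = evenExt f K α := by
  simp only [evenExt, abs_neg]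

/-- `evenExt` as an indicator. -/
theorem evenExt_eq_indicator (f : ℝ → ℝ) (K : ℝ) :
    evenExt f K = (Icc (-K) K).indicator (fun α ↦ f |α|) := by
  funext α
  unfold evenExt
  by_cases h : |α| ≤ K
  · rw [if_pos h, indicator_of_mem (mem_Icc.2 (abs_le.1 h))]
  · rw [if_neg h, indicator_of_notMem (fun h' ↦ h (abs_le.2 (mem_Icc.1 h')))]

/-- Value inside the window at a nonnegative point. -/
theorem evenExt_of_nonneg_le {f : ℝ → ℝ} {K α : ℝ} (h0 : 0 ≤ α) (h : α ≤ K) :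
    evenExt f K α = f α := by
  unfold evenExt
  rw [abs_of_nonneg h0, if_pos h]

/-- Value outside the window. -/
theorem evenExt_of_lt_abs {f : ℝ → ℝ} {K α : ℝ} (h : K < |α|) : evenExt f K α = 0 := by
  unfold evenExt
  rw [if_neg (not_le.2 h)]

/-- `evenExt f K ∈ L¹` for continuous `f`. -/
theorem integrable_evenExt {f : ℝ → ℝ} (hf : Continuous f) (K : ℝ) : Integrable (evenExt f K) := by
  rw [evenExt_eq_indicator]
  exact ((hf.comp continuous_abs).integrableOn_Icc).integrable_indicator measurableSet_Icc

/-- `evenExt f K` is continuous when `f` is and `f K = 0`. -/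
theorem continuous_evenExt {f : ℝ → ℝ} (hf : Continuous f) {K : ℝ} (hK : f K = 0) :
    Continuous (evenExt f K) := by
  have h := Continuous.if_le (f := fun α : ℝ ↦ |α|) (g := fun _ : ℝ ↦ K) (f' := fun α : ℝ ↦ f |α|)
    (g' := fun _ : ℝ ↦ (0 : ℝ)) (hf.comp continuous_abs) continuous_const continuous_abs
    continuous_const (fun α (hα : |α| = K) ↦ show f |α| = 0 by rw [hα, hK])
  exact h.congr fun α ↦ by unfold evenExt; rfl

/-- `evenExt f K ≥ 0` if `f ≥ 0` on `[0, K]`. -/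
theorem evenExt_nonneg {f : ℝ → ℝ} {K : ℝ} (hf : ∀ x, 0 ≤ x → x ≤ K → 0 ≤ f x) (α : ℝ) :
    0 ≤ evenExt f K α := by
  unfold evenExt
  split_ifs with h
  · exact hf _ (abs_nonneg α) h
  · exact le_rfl

/-- **Cosine transform of an even extension**: `2∫₀ᴷ f(α) cos(2πuα) dα`. -/
theorem cosTransform_evenExt {f : ℝ → ℝ} (hf : Continuous f) {K : ℝ} (hK : 0 ≤ K) (u : ℝ) :
    cosTransform (evenExt f K) u = 2 * ∫ α in (0 : ℝ)..K, f α * Real.cos (2 * π * u * α) := by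
  unfold cosTransform
  have h1 : (fun α ↦ evenExt f K α * Real.cos (2 * π * u * α)) =
      (Icc (-K) K).indicator (fun α ↦ f |α| * Real.cos (2 * π * u * α)) := by
    funext α
    rw [evenExt_eq_indicator, Set.indicator_mul_left]
  rw [h1, integral_indicator measurableSet_Icc, integral_Icc_eq_integral_Ioc,
    ← intervalIntegral.integral_of_le (by linarith)]
  have hc : Continuous fun α ↦ f |α| * Real.cos (2 * π * u * α) := by fun_prop
  rw [← intervalIntegral.integral_add_adjacent_intervals (hc.intervalIntegrable (-K) 0)
    (hc.intervalIntegrable 0 K)]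
  have hL : ∫ α in (-K)..0, f |α| * Real.cos (2 * π * u * α) =
      ∫ α in (0 : ℝ)..K, f α * Real.cos (2 * π * u * α) := by
    have h := intervalIntegral.integral_comp_neg (fun α ↦ f |α| * Real.cos (2 * π * u * α))
      (a := (0 : ℝ)) (b := K)
    rw [neg_zero] at h
    rw [← h]
    refine intervalIntegral.integral_congr fun α hα ↦ ?_
    rw [uIcc_of_le hK] at hα
    simp only [abs_neg, abs_of_nonneg hα.1, mul_neg, Real.cos_neg]
  have hR : ∫ α in (0 : ℝ)..K, f |α| * Real.cos (2 * π * u * α) =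
      ∫ α in (0 : ℝ)..K, f α * Real.cos (2 * π * u * α) := by
    refine intervalIntegral.integral_congr fun α hα ↦ ?_
    rw [uIcc_of_le hK] at hα
    simp only [abs_of_nonneg hα.1]
  rw [hL, hR]
  ring

/-! ## The polynomial bump and its autocorrelation -/

/-- The bump `H(ξ) = p(ξ²)` for `|ξ| ≤ a`, `0` otherwise (`p` a coefficient list). -/
def bump (p : Poly) (a : ℚ) : ℝ → ℝ := evenExt (fun x ↦ Poly.eval p (x ^ 2)) a

/-- The bump is even. -/
theorem bump_neg (p : Poly) (a : ℚ) (ξ : ℝ) : bump p a (-ξ) = bump p a ξ := evenExt_neg _ _ _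

/-- The bump is integrable. -/
theorem integrable_bump (p : Poly) (a : ℚ) : Integrable (bump p a) :=
  integrable_evenExt ((Poly.continuous_eval p).comp (continuous_pow 2)) _

/-- Pointwise formula for the bump. -/
theorem bump_apply (p : Poly) (a : ℚ) (ξ : ℝ) :
    bump p a ξ = if |ξ| ≤ a then Poly.eval p (ξ ^ 2) else 0 := by
  simp only [bump, evenExt, sq_abs]

/-- The autocorrelation `H ⋆ H` in closed form: the even extension to `[−2a, 2a]` of the
toolkit polynomial `conv p̃ p̃ a`, `p̃ = compSq p`. -/
def auto (p : Poly) (a : ℚ) : ℝ → ℝ :=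
  evenExt (Poly.eval (Poly.conv (Poly.compSq p) (Poly.compSq p) a)) (2 * a)

/-- `auto` is even. -/
theorem auto_neg (p : Poly) (a : ℚ) (α : ℝ) : auto p a (-α) = auto p a α := evenExt_neg _ _ _

/-- `auto` is integrable. -/
theorem integrable_auto (p : Poly) (a : ℚ) : Integrable (auto p a) :=
  integrable_evenExt (Poly.continuous_eval _) _

/-- **The autocorrelation integral** for `α ≥ 0`: `∫ H(t) H(α − t) dt = auto p a α`
(supports meet in `[α − a, a]`; the integral is the toolkit's `conv`). -/
theorem integral_bump_mul_bump_sub (p : Poly) {a : ℚ} (ha : 0 ≤ a) {α : ℝ} (h0 : 0 ≤ α) :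
    ∫ t, bump p a t * bump p a (α - t) = auto p a α := by
  have ha' : (0 : ℝ) ≤ a := by exact_mod_cast ha
  rcases le_or_gt α (2 * a) with hα | hα
  · have hpt : (fun t ↦ bump p a t * bump p a (α - t)) =
        (Icc (α - a) a).indicator
          (fun t ↦ Poly.eval (Poly.compSq p) t * Poly.eval (Poly.compSq p) (α - t)) := by
      funext t
      simp only [bump_apply, Poly.eval_compSq]
      by_cases ht : α - a ≤ t ∧ t ≤ a
      · rw [if_pos (abs_le.2 ⟨by linarith [ht.1], ht.2⟩),
          if_pos (abs_le.2 ⟨by linarith [ht.2], by linarith [ht.1]⟩),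
          indicator_of_mem (mem_Icc.2 ht)]
      · rw [indicator_of_notMem (fun h' ↦ ht (mem_Icc.1 h'))]
        by_cases h1 : |t| ≤ a
        · have h2 : ¬ |α - t| ≤ a := fun h2 ↦ ht ⟨by linarith [(abs_le.1 h2).2], (abs_le.1 h1).2⟩
          rw [if_neg h2, mul_zero]
        · rw [if_neg h1, zero_mul]
    rw [hpt, integral_indicator measurableSet_Icc, integral_Icc_eq_integral_Ioc,
      ← intervalIntegral.integral_of_le (by linarith), Poly.integral_conv]
    unfold auto
    rw [evenExt_of_nonneg_le h0 (by linarith)]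
  · have hpt : (fun t ↦ bump p a t * bump p a (α - t)) = fun _ ↦ 0 := by
      funext t
      simp only [bump_apply]
      by_cases h1 : |t| ≤ a
      · have h2 : ¬ |α - t| ≤ a := fun h2 ↦ by linarith [(abs_le.1 h1).2, (abs_le.1 h2).2]
        rw [if_neg h2, mul_zero]
      · rw [if_neg h1, zero_mul]
    rw [hpt, integral_zero]
    unfold auto
    rw [evenExt_of_lt_abs (by rw [abs_of_nonneg h0]; linarith)]

/-- **`H ⋆ H = auto`** (Mathlib convolution of the complexified bump with itself). -/
theorem convolution_bump (p : Poly) {a : ℚ} (ha : 0 ≤ a) (α : ℝ) :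
    ((fun x : ℝ ↦ (bump p a x : ℂ)) ⋆[ContinuousLinearMap.mul ℂ ℂ] (fun x : ℝ ↦ (bump p a x : ℂ))) α =
      (auto p a α : ℂ) := by
  have key : ∀ β : ℝ, 0 ≤ β →
      ((fun x : ℝ ↦ (bump p a x : ℂ)) ⋆[ContinuousLinearMap.mul ℂ ℂ] (fun x : ℝ ↦ (bump p a x : ℂ))) β =
        (auto p a β : ℂ) := by
    intro β hβ
    rw [convolution_def]
    simp only [ContinuousLinearMap.mul_apply']
    have e : (fun t : ℝ ↦ (bump p a t : ℂ) * (bump p a (β - t) : ℂ)) =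
        fun t : ℝ ↦ ((bump p a t * bump p a (β - t) : ℝ) : ℂ) := by
      funext t; push_cast; ring
    rw [e, integral_complex_ofReal, integral_bump_mul_bump_sub p ha hβ]
  rcases le_or_gt 0 α with h0 | h0
  · exact key α h0
  · have hev : ∀ᵐ x : ℝ ∂volume, (fun x : ℝ ↦ (bump p a x : ℂ)) (-x) = (fun x : ℝ ↦ (bump p a x : ℂ)) x :=
      Eventually.of_forall fun x ↦ by simp only [bump_neg]
    have h1 := convolution_neg_of_neg_eq (f := fun x : ℝ ↦ (bump p a x : ℂ))
      (g := fun x : ℝ ↦ (bump p a x : ℂ)) (L := ContinuousLinearMap.mul ℂ ℂ) (μ := volume)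
      (x := -α) hev hev
    rw [neg_neg] at h1
    rw [h1, key (-α) (by linarith), auto_neg]

/-- **`(H ⋆ H)^ = ĥ²`**: the cosine transform of the autocorrelation is the square of
`ĥ = cosTransform H` (Mathlib's `𝓕(f ⋆ f) = (𝓕f)²` and `𝓕 = cosTransform` on real even `L¹`). -/
theorem cosTransform_auto (p : Poly) {a : ℚ} (ha : 0 ≤ a) (u : ℝ) :
    cosTransform (auto p a) u = cosTransform (bump p a) u ^ 2 := by
  have hint : Integrable (fun x : ℝ ↦ (bump p a x : ℂ)) := (integrable_bump p a).ofReal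
  have h1 := Real.fourier_mul_convolution_eq hint hint u
  have h2 : ((fun x : ℝ ↦ (bump p a x : ℂ)) ⋆[ContinuousLinearMap.mul ℂ ℂ] (fun x : ℝ ↦ (bump p a x : ℂ))) =
      fun α : ℝ ↦ (auto p a α : ℂ) := funext (convolution_bump p ha)
  rw [h2, fourier_ofReal_eq_cosTransform (bump_neg p a) (integrable_bump p a),
    fourier_ofReal_eq_cosTransform (auto_neg p a) (integrable_auto p a)] at h1
  exact_mod_cast (show (cosTransform (auto p a) u : ℂ) = ((cosTransform (bump p a) u ^ 2 : ℝ) : ℂ) by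
    rw [h1]; push_cast; ring)

end Summit.RiemannHypothesis.RiemannHypothesis.Theorems.GapsEvoDoorsPW

end
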